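import Literature.NumberTheory.GaloisRepresentations.WeilGroup
import Literature.NumberTheory.GaloisRepresentations.AbsGaloisGroupCompact
import Mathlib.Topology.Algebra.OpenSubgroup
import Mathlib.GroupTheory.Archimedean
import Mathlib.GroupTheory.Index
import HarnessLib

/-!
# Repair D2-pst — the degree pin `f_U` exists and is unique for every open `U ≤ Γ_F`

Summit `Langlands`, companion of `Theorems/SoloInformedRepairD2Pst` (§3 `PstCompatibleAt`).  That clause
binds, for an open normal subgroup `U ≤ Γ_{K_v}` (`U = Γ_L`), a natural number `f_U` through the three
conjuncts
  `0 < f_U`, `∀ w ∈ W_{K_v}, w ∈ U → f_U ∣ deg w`, `∃ w ∈ W_{K_v}, w ∈ U ∧ deg w = f_U`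
("`deg (W_{K_v} ∩ U) = f_U ℤ`", i.e. `f_U = f(L/K_v)`), and then asks `rank D_{st,U} = n·f(v|ℓ)·f_U` and
Jordan data scaled by `f(v|ℓ)·f_U`.  The pin is NECESSARY for soundness (a partial `D_{st,L}` of the right
rank for a wrong multiplicity would be a false positive, module docstring of that file).  This file proves
that the pin never OBSTRUCTS and really PINS:

* `IsDegPin U fU` — the three conjuncts verbatim, for any subgroup `U ≤ Γ_F` of the absolute Galois group
  of a non-archimedean local field `F`;
* `IsDegPin.unique` — two pins of the same `U` are equal (`f_U` is a function of `U`);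
* `IsDegPin.dvd_of_le` — `U' ≤ U ⇒ f_U ∣ f_{U'}` (residue degrees grow along the tower);
* `isDegPin_top_one` — `f_⊤ = 1` (so at `U = ⊤` the multiplicity of `PstCompatibleAt` is D2-st's `f(v|ℓ)`);
* `IsDegPin.le_index` — `f_U ≤ [Γ_F : U]` (`f(L/F) ≤ [L : F]`);
* `exists_isDegPin` — every finite-index `U` has a pin: `deg (W_F ∩ U)` is a subgroup of `ℤ`
  (`degSubgroupOn`), non-zero because an arithmetic Frobenius `w₁` (`deg w₁ = 1`, `deg_surjective`) has a
  power `w₁^N ∈ U` with `0 < N ≤ [Γ_F : U]`, hence `= f_U ℤ` with `f_U > 0` (`Int.subgroup_cyclic`);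
* `exists_isDegPin_of_isOpen`, `existsUnique_isDegPin` — the case of the clause: an OPEN (normal) subgroup
  of the compact group `Γ_F` (`absoluteGaloisGroup_compactSpace`) has finite index.

All statements carry the tree's named Weil-group facts `IsFrobPow.mul`, `IsFrobPow.unique`,
`exists_isFrobPow` as hypotheses, exactly as `WeilGroup.deg_mul` / `deg_surjective` do.  Consequence for the
repair menu (`SHARPEST-CORE.md` §3): in `PstCompatibleAt` the existential `∃ U f_U, pin ∧ (i) ∧ (ii)` is
equivalent to `∃ U, (i) ∧ (ii)` read at THE `f_U` of `U`; the clause's content is (i) ∧ (ii) alone.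
A Theorems-side certificate; the Statement is unchanged.

References: J. Tate, *Number theoretic background*, Corvallis 1979, (1.4.1)–(1.4.6) (`deg`, `W_L = W_K ∩ Γ_L`,
`‖·‖_L = ‖·‖_K^{[L:K]}` up to the residue degree); J.-M. Fontaine, Astérisque 223, Exp. VIII §2.3.7
(`D_{st,L}`, `α(w) = f_L · deg w`).
-/

noncomputable section

open Field

namespace Summit.Langlands.Langlands.Theorems

namespace D2Pst

open Literature.NumberTheory.GaloisRepresentations

variable {F : Type*} [Field F] [ValuativeRel F] [TopologicalSpace F] [IsNonarchimedeanLocalField F]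

/-! ### §1 The pin as a predicate; uniqueness, monotonicity, the top subgroup -/

/-- **The degree pin of `PstCompatibleAt`**: `f_U > 0`, every Weil element lying in `U` has degree divisible
by `f_U`, and some Weil element of `U` has degree exactly `f_U` — i.e. `deg (W_F ∩ U) = f_U ℤ`
(`f_U = f(L/F)` for `U = Γ_L`).  The three conjuncts of `D2Pst.PstCompatibleAt` verbatim.
[cite: TateCorvallis1979, §1.4 (1.4.1)–(1.4.6)] -/
def IsDegPin (U : Subgroup (absoluteGaloisGroup F)) (fU : ℕ) : Prop :=
  0 < fU ∧
    (∀ w : WeilGroup F, WeilGroup.toAbsGalois F w ∈ U → (fU : ℤ) ∣ WeilGroup.deg w) ∧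
    (∃ w : WeilGroup F, WeilGroup.toAbsGalois F w ∈ U ∧ WeilGroup.deg w = fU)

/-- **The pin pins**: two degree pins of the same subgroup coincide (each divides the other).
[cite: TateCorvallis1979, §1.4 (1.4.1)] -/
theorem IsDegPin.unique {U : Subgroup (absoluteGaloisGroup F)} {fU fU' : ℕ}
    (h : IsDegPin U fU) (h' : IsDegPin U fU') : fU = fU' := by
  obtain ⟨-, hdvd, w, hwU, hw⟩ := h
  obtain ⟨-, hdvd', w', hw'U, hw'⟩ := h'
  have h1 : (fU : ℤ) ∣ (fU' : ℤ) := hw' ▸ hdvd w' hw'U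
  have h2 : (fU' : ℤ) ∣ (fU : ℤ) := hw ▸ hdvd' w hwU
  exact Nat.dvd_antisymm (Int.natCast_dvd_natCast.mp h1) (Int.natCast_dvd_natCast.mp h2)

/-- **Monotonicity**: along `U' ≤ U` the pin of the smaller subgroup is a multiple of the pin of the larger
(`f(L'/F) = f(L'/L) · f(L/F)`). [cite: TateCorvallis1979, §1.4 (1.4.6)] -/
theorem IsDegPin.dvd_of_le {U U' : Subgroup (absoluteGaloisGroup F)} {fU fU' : ℕ} (hle : U' ≤ U)
    (h : IsDegPin U fU) (h' : IsDegPin U' fU') : fU ∣ fU' := by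
  obtain ⟨-, hdvd, -⟩ := h
  obtain ⟨-, -, w', hw'U, hw'⟩ := h'
  exact Int.natCast_dvd_natCast.mp (hw' ▸ hdvd w' (hle hw'U))

/-- **`f_⊤ = 1`**: on the whole Galois group the pin is `1` (an arithmetic Frobenius has degree `1`,
`deg_surjective`); so at `U = ⊤` the multiplicity `f(v|ℓ)·f_U` of `PstCompatibleAt` is D2-st's `f(v|ℓ)`.
[cite: TateCorvallis1979, §1.4 (1.4.1)–(1.4.4)] -/
theorem isDegPin_top_one (hmul : IsFrobPow.mul (F := F)) (huniq : IsFrobPow.unique (F := F))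
    (hex : exists_isFrobPow (F := F)) : IsDegPin (⊤ : Subgroup (absoluteGaloisGroup F)) 1 := by
  obtain ⟨w₁, hw₁⟩ := WeilGroup.deg_surjective hmul huniq hex 1
  exact ⟨Nat.one_pos, fun w _ => by simp, w₁, Subgroup.mem_top _, by simpa using hw₁⟩

/-! ### §2 Existence: `deg (W_F ∩ U)` is a non-zero subgroup of `ℤ` for `U` of finite index -/

/-- `deg (w ^ n) = n · deg w`. [cite: TateCorvallis1979, §1.4 (1.4.1)] -/
theorem deg_pow (hmul : IsFrobPow.mul (F := F)) (huniq : IsFrobPow.unique (F := F)) (w : WeilGroup F)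
    (n : ℕ) : WeilGroup.deg (w ^ n) = n * WeilGroup.deg w := by
  induction n with
  | zero => simp [WeilGroup.deg_one hmul huniq]
  | succ n ih =>
    rw [pow_succ, WeilGroup.deg_mul hmul huniq, ih]
    push_cast
    ring

/-- **`deg (W_F ∩ U)` as a subgroup of `ℤ`**: the degrees of the Weil elements lying in `U` (closed under
`0`, `+`, `-` by `deg_one`, `deg_mul`, `deg_inv` and the subgroup axioms of `U`).
[cite: TateCorvallis1979, §1.4 (1.4.1)] -/
def degSubgroupOn (hmul : IsFrobPow.mul (F := F)) (huniq : IsFrobPow.unique (F := F))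
    (U : Subgroup (absoluteGaloisGroup F)) : AddSubgroup ℤ where
  carrier := {d : ℤ | ∃ w : WeilGroup F, WeilGroup.toAbsGalois F w ∈ U ∧ WeilGroup.deg w = d}
  zero_mem' := ⟨1, by rw [map_one]; exact U.one_mem, WeilGroup.deg_one hmul huniq⟩
  add_mem' := by
    rintro _ _ ⟨w, hw, rfl⟩ ⟨w', hw', rfl⟩
    exact ⟨w * w', by rw [map_mul]; exact U.mul_mem hw hw', WeilGroup.deg_mul hmul huniq w w'⟩
  neg_mem' := by
    rintro _ ⟨w, hw, rfl⟩
    exact ⟨w⁻¹, by rw [map_inv]; exact U.inv_mem hw, WeilGroup.deg_inv hmul huniq w⟩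

/-- Membership in `degSubgroupOn`. [cite: TateCorvallis1979, §1.4 (1.4.1)] -/
theorem mem_degSubgroupOn_iff (hmul : IsFrobPow.mul (F := F)) (huniq : IsFrobPow.unique (F := F))
    {U : Subgroup (absoluteGaloisGroup F)} {d : ℤ} :
    d ∈ degSubgroupOn hmul huniq U ↔
      ∃ w : WeilGroup F, WeilGroup.toAbsGalois F w ∈ U ∧ WeilGroup.deg w = d :=
  Iff.rfl

/-- **A positive degree inside any finite-index `U`**: an arithmetic Frobenius `w₁` (`deg w₁ = 1`) has a power
`w₁ ^ N ∈ U` with `0 < N ≤ [Γ_F : U]`, of degree `N`. [cite: TateCorvallis1979, §1.4 (1.4.1)–(1.4.4)] -/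
theorem exists_pos_mem_degSubgroupOn (hmul : IsFrobPow.mul (F := F)) (huniq : IsFrobPow.unique (F := F))
    (hex : exists_isFrobPow (F := F)) (U : Subgroup (absoluteGaloisGroup F)) [U.FiniteIndex] :
    ∃ N : ℕ, 0 < N ∧ N ≤ U.index ∧ (N : ℤ) ∈ degSubgroupOn hmul huniq U := by
  obtain ⟨w₁, hw₁⟩ := WeilGroup.deg_surjective hmul huniq hex 1
  obtain ⟨N, hNpos, hNle, hNmem⟩ :=
    U.exists_pow_mem_of_index_ne_zero Subgroup.FiniteIndex.index_ne_zero (WeilGroup.toAbsGalois F w₁)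
  exact ⟨N, hNpos, hNle, w₁ ^ N, by rwa [map_pow], by rw [deg_pow hmul huniq, hw₁, mul_one]⟩

/-- **Existence of the pin** for every subgroup `U ≤ Γ_F` of finite index: `deg (W_F ∩ U) = f_U ℤ` with
`0 < f_U` (subgroups of `ℤ` are cyclic; non-zero by `exists_pos_mem_degSubgroupOn`), and the generator is
attained inside `U` (replace a witness of degree `-f_U` by its inverse).
[cite: TateCorvallis1979, §1.4 (1.4.1)–(1.4.6)] -/
theorem exists_isDegPin (hmul : IsFrobPow.mul (F := F)) (huniq : IsFrobPow.unique (F := F))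
    (hex : exists_isFrobPow (F := F)) (U : Subgroup (absoluteGaloisGroup F)) [U.FiniteIndex] :
    ∃ fU : ℕ, IsDegPin U fU := by
  obtain ⟨a, ha⟩ := Int.subgroup_cyclic (degSubgroupOn hmul huniq U)
  obtain ⟨N, hNpos, -, hNmem⟩ := exists_pos_mem_degSubgroupOn hmul huniq hex U
  have ha0 : a ≠ 0 := by
    rintro rfl
    rw [ha, AddSubgroup.mem_closure_singleton] at hNmem
    obtain ⟨n, hn⟩ := hNmem
    rw [smul_zero] at hn
    omega
  have hamem : a ∈ degSubgroupOn hmul huniq U := by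
    rw [ha]
    exact AddSubgroup.subset_closure rfl
  refine ⟨a.natAbs, Int.natAbs_pos.mpr ha0, fun w hw => ?_, ?_⟩
  · have hmem : WeilGroup.deg w ∈ degSubgroupOn hmul huniq U := ⟨w, hw, rfl⟩
    rw [ha, AddSubgroup.mem_closure_singleton] at hmem
    obtain ⟨n, hn⟩ := hmem
    rw [Int.natAbs_dvd]
    exact ⟨n, by rw [← hn, smul_eq_mul, mul_comm]⟩
  · obtain ⟨w, hwU, hw⟩ := hamem
    rcases Int.natAbs_eq a with h | h
    · exact ⟨w, hwU, by rw [hw]; exact h⟩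
    · refine ⟨w⁻¹, by rw [map_inv]; exact U.inv_mem hwU, ?_⟩
      rw [WeilGroup.deg_inv hmul huniq, hw]
      omega

/-- **`f_U ≤ [Γ_F : U]`**: a pin divides the positive degree `N ≤ [Γ_F : U]` found in `U`
(`exists_pos_mem_degSubgroupOn`), so it is at most the index (`f(L/F) ≤ [L : F]`).
[cite: TateCorvallis1979, §1.4 (1.4.6)] -/
theorem IsDegPin.le_index (hmul : IsFrobPow.mul (F := F)) (huniq : IsFrobPow.unique (F := F))
    (hex : exists_isFrobPow (F := F)) {U : Subgroup (absoluteGaloisGroup F)} [U.FiniteIndex] {fU : ℕ}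
    (h : IsDegPin U fU) : fU ≤ U.index := by
  obtain ⟨N, hNpos, hNle, w, hwU, hw⟩ := exists_pos_mem_degSubgroupOn hmul huniq hex U
  obtain ⟨-, hdvd, -⟩ := h
  have hfN : fU ∣ N := Int.natCast_dvd_natCast.mp (hw ▸ hdvd w hwU)
  exact (Nat.le_of_dvd hNpos hfN).trans hNle

/-! ### §3 The case of the clause: open (normal) subgroups of the compact group `Γ_F` -/

/-- **Existence of the pin for an OPEN subgroup** `U ≤ Γ_F`: `Γ_F` is compact
(`absoluteGaloisGroup_compactSpace`), so `Γ_F ⧸ U` is finite and `U` has finite index.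
[cite: TateCorvallis1979, §1.4 (1.4.1)–(1.4.6)] -/
theorem exists_isDegPin_of_isOpen (hmul : IsFrobPow.mul (F := F)) (huniq : IsFrobPow.unique (F := F))
    (hex : exists_isFrobPow (F := F)) (U : Subgroup (absoluteGaloisGroup F))
    (hU : IsOpen (U : Set (absoluteGaloisGroup F))) : ∃ fU : ℕ, IsDegPin U fU := by
  haveI : CompactSpace (absoluteGaloisGroup F) := absoluteGaloisGroup_compactSpace F
  haveI : Finite (absoluteGaloisGroup F ⧸ U) := Subgroup.quotient_finite_of_isOpen U hU
  haveI : U.FiniteIndex := Subgroup.finiteIndex_of_finite_quotient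
  exact exists_isDegPin hmul huniq hex U

/-- **The pin of `PstCompatibleAt` exists and is unique** for every open normal subgroup `U ≤ Γ_F` — the
binder type of the clause.  Hence `∃ U f_U, pin U f_U ∧ (i) ∧ (ii)` there is equivalent to
`∃ U, (i) ∧ (ii)` at the `f_U` of `U`: the pin never obstructs and fixes the multiplicity.
[cite: TateCorvallis1979, §1.4 (1.4.1)–(1.4.6)] [cite: FontaineAsterisque223VIII, §2.3.7] -/
theorem existsUnique_isDegPin (hmul : IsFrobPow.mul (F := F)) (huniq : IsFrobPow.unique (F := F))
    (hex : exists_isFrobPow (F := F)) (U : OpenNormalSubgroup (absoluteGaloisGroup F)) :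
    ∃! fU : ℕ, IsDegPin (U : Subgroup (absoluteGaloisGroup F)) fU := by
  obtain ⟨fU, hfU⟩ := exists_isDegPin_of_isOpen hmul huniq hex (U : Subgroup (absoluteGaloisGroup F)) U.isOpen
  exact ⟨fU, hfU, fun fU' hfU' => hfU'.unique hfU⟩

/-- **Eliminating the pin**: for an open normal `U` and any property `P` of the multiplicity, the pinned
existential `∃ f_U, IsDegPin U f_U ∧ P f_U` holds iff `P` holds at some (equivalently: the) pin of `U` —
the shape in which `PstCompatibleAt` uses it (`P f_U` = "(i) rank `= n·f(v|ℓ)·f_U` ∧ (ii) Jordan data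
`× f(v|ℓ)·f_U`"). [cite: TateCorvallis1979, §1.4 (1.4.1)–(1.4.6)] -/
theorem exists_isDegPin_and_iff (hmul : IsFrobPow.mul (F := F)) (huniq : IsFrobPow.unique (F := F))
    (hex : exists_isFrobPow (F := F)) (U : OpenNormalSubgroup (absoluteGaloisGroup F)) (P : ℕ → Prop) :
    (∃ fU : ℕ, IsDegPin (U : Subgroup (absoluteGaloisGroup F)) fU ∧ P fU) ↔
      ∀ fU : ℕ, IsDegPin (U : Subgroup (absoluteGaloisGroup F)) fU → P fU := by
  obtain ⟨f₀, hf₀, huniq₀⟩ := existsUnique_isDegPin hmul huniq hex U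
  refine ⟨?_, fun h => ⟨f₀, hf₀, h f₀ hf₀⟩⟩
  rintro ⟨fU, hfU, hP⟩ fU' hfU'
  rw [huniq₀ fU' hfU', ← huniq₀ fU hfU]
  exact hP

end D2Pst

end Summit.Langlands.Langlands.Theorems
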